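import Mathlib
import Summits.PneNP.PneNP.Theorems.OverlapGapAlgebraSearchHardWindowMeanSquareRate
import Summits.PneNP.PneNP.Theorems.OverlapGapAlgebraSearchHardWindowSequentialLocalSens

/-!
# PneNP / OverlapGapAlgebra — `SearchHardWindow`:
# SEQUENTIAL LOCAL RULES are ℓ²-stable (4/4) — the rung: index-order decimation fails in the window

Support for crux `stmt-PneNP-2460` (`Summit.PneNP.PneNP.Theses.OverlapGapAlgebra.SearchHardWindow`).
A search map `g` on `F_k(n, m)` is an INDEX-ORDER DECIMATION RULE WITH UNIT LOOK-AHEAD (hypothesis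
`hseq`, definition-free) if its bit at `v` is an arbitrary label-dependent function of the labelled
clauses containing `v` and of its own bits at the smaller variables occurring in them — the
variables are assigned one by one in a fixed order, each by a local rule applied to the formula
decimated so far (Unit-Clause-type rules without reordering, one-round message-passing-guided
decimation; the radius-one case of the "sequential local algorithms" of Gamarnik–Sudan, SICOMP 2017,
there for NAE-`k`-SAT). By `shwSeq_meanSquare` such maps are ℓ²-stable with a CONSTANT mean-square
sensitivity `S(k, α) = (k+1)² (1+αk²) e^{αk²(1+k²+αk²)}`, so the mean-square rung and rate
(`shwMSR_successCount_le_rate`, resting on the proved probability crux `NoStableSection`) apply: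

* `shwSeq_isLittleO` — the constant scale is admissible;
* `shwSeq_seqLocalMapsFail_rate` — UNCONDITIONALLY: for `k ≥ k₀` there is `C` with: eventually in
  `n`, EVERY index-order decimation rule with unit look-ahead solves at most a `C log² n / n`
  fraction of `F_k(n, ⌊α_k n⌋)`, `α_k = 5·2^k log k/k` — the first rung of the crux for an
  ADAPTIVE class (`n` rounds of dependence, unbounded radius);
* `shwSeq_seqLocalMapsFail` — the same at every constant level `ε`;
* `shwSeq_hardnessConjunct_window` — the hardness conjunct of `SearchHardWindow`, verbatim shape,
  for ANY `f : List Bool → List Bool` (no complexity hypothesis) whose decoded assignment on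
  `F_k(n, ⌊α_k n⌋)` is, eventually in `n`, such a rule.
No definitions; axioms `propext`, `Classical.choice`, `Quot.sound`.
-/

set_option linter.dupNamespace false -- `Summit.PneNP.PneNP.…`: summit = sub-problem (D-0017)

namespace Summit.PneNP.PneNP.Theorems

open Finset Filter Asymptotics
open scoped Classical

section SeqRung

/-- The constant sensitivity scale is admissible: `S · log³ n = o(n)`. -/
theorem shwSeq_isLittleO (S : ℝ) :
    (fun n : ℕ => S * Real.log n ^ 3) =o[atTop] (fun n : ℕ => (n : ℝ)) := by
  have h1 : (fun n : ℕ => Real.log n ^ 3) =o[atTop] (fun n : ℕ => (n : ℝ)) := by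
    have := (Real.isLittleO_pow_log_id_atTop (n := 3)).comp_tendsto tendsto_natCast_atTop_atTop
    simpa [Function.comp_def] using this
  exact h1.const_mul_left S

/-- **Index-order decimation with unit look-ahead fails in the Bresler–Huang window, with a
polynomial rate (unconditional).** For all `k ≥ k₀` there is `C > 0` such that, eventually in `n`,
every index-order decimation rule with unit look-ahead on `F_k(n, ⌊α_k n⌋)`, `α_k = 5·2^k log k/k`,
solves at most a `C log² n / n` fraction of the instances. -/
theorem shwSeq_seqLocalMapsFail_rate :
    ∃ k₀ : ℕ, ∀ k : ℕ, k₀ ≤ k → ∃ C : ℝ, 0 < C ∧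
      ∀ᶠ n : ℕ in atTop, ∀ m : ℕ, m = ⌊5 * 2 ^ k * Real.log k / k * n⌋₊ →
        ∀ g : (Fin m → Fin k → Fin n × Bool) → (Fin n → Bool), (∀ (Φ Φ' : (Fin m → Fin k → Fin n × Bool)) (v : Fin n),
        (∀ i : Fin m, ((∃ j : Fin k, (Φ i j).1 = v) ∨ (∃ j : Fin k, (Φ' i j).1 = v)) → Φ i = Φ' i) →
        (∀ (i : Fin m) (j j' : Fin k), (Φ i j).1 = v → (Φ i j').1 < v →
          g Φ (Φ i j').1 = g Φ' (Φ i j').1) →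
        g Φ v = g Φ' v) →
          ((Finset.univ.filter fun Φ : Fin m → Fin k → Fin n × Bool =>
              ∀ i, ∃ j, g Φ (Φ i j).1 = (Φ i j).2).card : ℝ)
            ≤ C * Real.log n ^ 2 / n * Fintype.card (Fin m → Fin k → Fin n × Bool) := by
  obtain ⟨k₀, h⟩ := shwMSR_successCount_le_rate
  refine ⟨k₀, fun k hk => ?_⟩
  obtain ⟨C₀, hC₀, hmain⟩ := h k hk
  set α : ℝ := 5 * 2 ^ k * Real.log k / k with hαdef
  have hα : 0 ≤ α := by
    rw [hαdef]
    exact div_nonneg (mul_nonneg (by positivity) (Real.log_natCast_nonneg k)) (Nat.cast_nonneg k)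
  set β : ℝ := α * (k : ℝ) ^ 2 with hβdef
  have hβ : 0 ≤ β := by rw [hβdef]; positivity
  set S : ℝ := ((k : ℝ) + 1) ^ 2 * ((1 + β) * Real.exp (β * (1 + (k : ℝ) ^ 2 + β))) with hSdef
  have hS : 0 ≤ S := by rw [hSdef]; positivity
  refine ⟨C₀ * (1 + S), mul_pos hC₀ (by linarith), ?_⟩
  have hev := hmain (fun _ : ℕ => S) (shwSeq_isLittleO S)
  filter_upwards [hev, eventually_ge_atTop 3] with n hn hn3 m hm g hseq
  have hn1 : 1 ≤ n := le_trans (by norm_num) hn3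
  have hn3R : (3 : ℝ) ≤ n := by exact_mod_cast hn3
  have hnpos : (0 : ℝ) < n := by linarith only [hn3R]
  have hm_le : (m : ℝ) ≤ α * n := by rw [hm]; exact Nat.floor_le (by positivity)
  have hβn : (m : ℝ) * (k : ℝ) ^ 2 ≤ β * n := by
    rw [hβdef]
    have hk2 : (0 : ℝ) ≤ (k : ℝ) ^ 2 := by positivity
    nlinarith [mul_le_mul_of_nonneg_right hm_le hk2]
  have hMS := shwSeq_meanSquare hn1 β hβn g hseq
  have hle := hn m hm g hS hMS
  have hL1 : 1 ≤ Real.log n := by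
    rw [← Real.log_exp 1]
    apply Real.log_le_log (Real.exp_pos 1)
    have : Real.exp 1 ≤ 3 := le_of_lt (lt_trans Real.exp_one_lt_d9 (by norm_num))
    exact this.trans hn3R
  have hL2 : 1 ≤ Real.log n ^ 2 := one_le_pow₀ hL1
  have hcoef : C₀ * (1 + Real.log n ^ 2 * S) / n ≤ C₀ * (1 + S) * Real.log n ^ 2 / n := by
    apply div_le_div_of_nonneg_right _ hnpos.le
    have : 1 + Real.log n ^ 2 * S ≤ (1 + S) * Real.log n ^ 2 := by nlinarith
    calc C₀ * (1 + Real.log n ^ 2 * S) ≤ C₀ * ((1 + S) * Real.log n ^ 2) :=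
          mul_le_mul_of_nonneg_left this hC₀.le
      _ = C₀ * (1 + S) * Real.log n ^ 2 := by ring
  have hNnn : (0 : ℝ) ≤ Fintype.card (Fin m → Fin k → Fin n × Bool) := Nat.cast_nonneg _
  exact hle.trans (mul_le_mul_of_nonneg_right hcoef hNnn)

/-- **Index-order decimation with unit look-ahead fails in the window at every constant success
level (unconditional).** For all `k ≥ k₀` and every `ε > 0`, eventually in `n`, every such rule on
`F_k(n, ⌊α_k n⌋)` solves at most an `ε`-fraction of the instances. -/
theorem shwSeq_seqLocalMapsFail :
    ∃ k₀ : ℕ, ∀ k : ℕ, k₀ ≤ k → ∀ ε : ℝ, 0 < ε →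
      ∀ᶠ n : ℕ in atTop, ∀ m : ℕ, m = ⌊5 * 2 ^ k * Real.log k / k * n⌋₊ →
        ∀ g : (Fin m → Fin k → Fin n × Bool) → (Fin n → Bool), (∀ (Φ Φ' : (Fin m → Fin k → Fin n × Bool)) (v : Fin n),
        (∀ i : Fin m, ((∃ j : Fin k, (Φ i j).1 = v) ∨ (∃ j : Fin k, (Φ' i j).1 = v)) → Φ i = Φ' i) →
        (∀ (i : Fin m) (j j' : Fin k), (Φ i j).1 = v → (Φ i j').1 < v →
          g Φ (Φ i j').1 = g Φ' (Φ i j').1) →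
        g Φ v = g Φ' v) →
          ((Finset.univ.filter fun Φ : Fin m → Fin k → Fin n × Bool =>
              ∀ i, ∃ j, g Φ (Φ i j).1 = (Φ i j).2).card : ℝ)
            ≤ ε * Fintype.card (Fin m → Fin k → Fin n × Bool) := by
  obtain ⟨k₀, h⟩ := shwSeq_seqLocalMapsFail_rate
  refine ⟨k₀, fun k hk ε hε => ?_⟩
  obtain ⟨C, hC, hrate⟩ := h k hk
  have hlog : (fun n : ℕ => Real.log n ^ 2) =o[atTop] (fun n : ℕ => (n : ℝ)) := by
    have := (Real.isLittleO_pow_log_id_atTop (n := 2)).comp_tendsto tendsto_natCast_atTop_atTop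
    simpa [Function.comp_def] using this
  have hsmall := hlog.def (div_pos hε hC)
  filter_upwards [hrate, hsmall, eventually_ge_atTop 1] with n hn hsm hn1 m hm g hseq
  have hnpos : (0 : ℝ) < n := by exact_mod_cast hn1
  have hNnn : (0 : ℝ) ≤ Fintype.card (Fin m → Fin k → Fin n × Bool) := Nat.cast_nonneg _
  refine (hn m hm g hseq).trans (mul_le_mul_of_nonneg_right ?_ hNnn)
  rw [Real.norm_eq_abs, Real.norm_eq_abs, abs_of_nonneg (by positivity),
    abs_of_nonneg hnpos.le] at hsm
  rw [div_le_iff₀ hnpos]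
  calc C * Real.log n ^ 2 ≤ C * (ε / C * n) := mul_le_mul_of_nonneg_left hsm hC.le
    _ = ε * n := by field_simp

end SeqRung

section SeqWindow

/-- **The sequential local rung for the crux's hardness conjunct (verbatim shape, in the
window).** For all `k ≥ k₀` and ANY `f : List Bool → List Bool` (no complexity hypothesis) whose
decoded assignment `Φ ↦ (v ↦ (f ⌜Φ⌝).getD v false)` on `F_k(n, ⌊α_k n⌋)` is, eventually in `n`, an
index-order decimation rule with unit look-ahead, the hardness conjunct of `SearchHardWindow`
holds for `f` at `(k, α_k)`: its success ratio is eventually `≤ ε`, for every `ε > 0`. -/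
theorem shwSeq_hardnessConjunct_window :
    ∃ k₀ : ℕ, ∀ k : ℕ, k₀ ≤ k → ∀ (f : List Bool → List Bool),
      (∀ᶠ n : ℕ in atTop, ∀ m : ℕ, m = ⌊5 * 2 ^ k * Real.log k / k * n⌋₊ →
        (∀ (Φ Φ' : (Fin m → Fin k → Fin n × Bool)) (v : Fin n),
        (∀ i : Fin m, ((∃ j : Fin k, (Φ i j).1 = v) ∨ (∃ j : Fin k, (Φ' i j).1 = v)) → Φ i = Φ' i) →
        (∀ (i : Fin m) (j j' : Fin k), (Φ i j).1 = v → (Φ i j').1 < v →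
          (f (Literature.Computability.Complexity.encodingCNF.encode (List.ofFn fun a =>
            List.ofFn fun b => (((Φ a b).1 : ℕ), (Φ a b).2)))).getD (Φ i j').1 false =
          (f (Literature.Computability.Complexity.encodingCNF.encode (List.ofFn fun a =>
            List.ofFn fun b => (((Φ' a b).1 : ℕ), (Φ' a b).2)))).getD (Φ i j').1 false) →
        (f (Literature.Computability.Complexity.encodingCNF.encode (List.ofFn fun a =>
            List.ofFn fun b => (((Φ a b).1 : ℕ), (Φ a b).2)))).getD v false =
        (f (Literature.Computability.Complexity.encodingCNF.encode (List.ofFn fun a =>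
            List.ofFn fun b => (((Φ' a b).1 : ℕ), (Φ' a b).2)))).getD v false)) →
      ∀ ε : ℝ, 0 < ε → ∀ᶠ n : ℕ in Filter.atTop, ∀ m : ℕ, m = ⌊5 * 2 ^ k * Real.log k / k * n⌋₊ →
        ((Finset.univ.filter fun Φ : Fin m → Fin k → Fin n × Bool => ∀ i, ∃ j,
            (f (Literature.Computability.Complexity.encodingCNF.encode (List.ofFn fun a =>
              List.ofFn fun b => (((Φ a b).1 : ℕ), (Φ a b).2)))).getD (Φ i j).1 false =
                (Φ i j).2).card : ℝ) / Fintype.card (Fin m → Fin k → Fin n × Bool) ≤ ε := by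
  obtain ⟨k₀, h⟩ := shwSeq_seqLocalMapsFail
  refine ⟨k₀, fun k hk f hf ε hε => ?_⟩
  filter_upwards [h k hk ε hε, hf, eventually_ge_atTop 1] with n hn hfn hn1
  intro m hm
  have hpos : (0 : ℝ) < Fintype.card (Fin m → Fin k → Fin n × Bool) := by
    have : 0 < n := hn1
    have : Nonempty (Fin n) := ⟨⟨0, this⟩⟩
    exact_mod_cast Fintype.card_pos
  have key := hn m hm (fun Φ v => (f (Literature.Computability.Complexity.encodingCNF.encode
    (List.ofFn fun a => List.ofFn fun b => (((Φ a b).1 : ℕ), (Φ a b).2)))).getD v false) (hfn m hm)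
  rw [div_le_iff₀ hpos]
  exact key

end SeqWindow

end Summit.PneNP.PneNP.Theorems
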